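import Literature.NumberTheory.Automorphic.Liu2021.ThetaLiftFromLineRealises
import Literature.NumberTheory.Automorphic.HilbertRepOrthogonalDecomposition
import HarnessLib

-- As in the lineage (★ `F0LD1MeetsOfRealises`): statements over the theta-kernel datum elaborate to very large types; elaborate sequentially.
set_option Elab.async false

/-!
# Crux `HLiu418`, line LD2 — the CONVERSE census lemma: the realisation letter (B6) `Liu2021.ThetaLiftFromLineRealises` together with (I′)
# `ThetaLiftFromLineIrreducible` IMPLIES multiplicity one of the `(a, ξ)`-theta span in `L²([U(H)])` (the isoclinic-copy argument)

Cell hodgecm-mathlib (D-0151), FLOOR 0; crux item `HLiu418` = stmt-HodgeConjecture-24832; printed letter stub `stub_letter_B6` of both LD leaves.  Seat LD2-p01 (g4),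
COST-CENSUS by-product (LEAD «M-96» (2), 2026-09-02), sibling of HOME `F0LD2ThetaRealisesOfMultiplicityOne` (the direction (I′) ∧ (M1θ) ⟹ (B6)).  THEOREMS ONLY (no
`def`, no instance, no notation, no named fact, no `sorry`); `--supports stmt-HodgeConjecture-24832` if ever filed.  HC_CM is proved only modulo the 7 printed citations
(2 remaining: hLiu418 = stmt-HodgeConjecture-24832, h413 = stmt-HodgeConjecture-24833) until rung 0 closes; nothing printed is discharged and no row is booked here.

THE POINT.  With ★ `F0LD2ThetaRealisesOfMultiplicityOne` this file closes the census claim «given (I′), the typed letter (B6) IS multiplicity one of the theta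
representation `Θ(a, ξ) ⊆ L²([U(H)])`» into a kernel-checked EQUIVALENCE: here (B6) ∧ (I′) ⟹ (M1θ).

* §1 `eq_of_areUnitarilyEquivalent_of_realises` — pure Hilbert space [DeitmarEchterhoff2014, Cor. 6.1.9; Dixmier1977, §5.4] (unitarity of `π` NOT needed): `Q` an irreducible
  closed invariant subspace whose carrier is the closure of the span of a set `S`, and suppose the REALISATION PROPERTY «every irreducible closed invariant `W` with
  `pr_W v ≠ 0` for some `v ∈ S` lies inside `Q`».  Then every irreducible closed invariant `W` unitarily equivalent to `Q` equals `Q`.  Proof: if `pr_W` sees a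
  generator, `W ≤ Q` and irreducibility of `Q` gives `W = Q` (★ `ClosedSubrep.eq_of_le_of_isTopIrreducible`); otherwise `pr_W` kills `S`, its span and its closure, so
  `Q ⟂ W`, and for the isometric intertwiner `f : Q → W` the ISOCLINIC COPY `R := {(√2)⁻¹ (q + f q)}` is a closed invariant subspace (★ `ClosedSubrep.ofLinearIsometry`)
  unitarily equivalent to `Q` (★ `ClosedSubrep.equivOfLinearIsometry`), hence irreducible (★ `isTopIrreducible_congr`); a non-zero generator `v ∈ S` has
  `⟪(√2)⁻¹(v + f v), v⟫ = (√2)⁻¹ ‖v‖² ≠ 0`, so `pr_R v ≠ 0`, the realisation property gives `R ≤ Q`, whence `f v ∈ Q ∩ W = 0` and `v = 0` — absurd.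
* §2 `multiplicityOne_of_thetaLiftFromLineRealises` — the theta specialisation: (B6) `ThetaLiftFromLineRealises …` ∧ (I′) `ThetaLiftFromLineIrreducible …` ⟹ (M1θ)
  «for every closed invariant `Q` whose carrier is the closed `(a, ξ)`-theta span, every discrete automorphic `P` unitarily equivalent to `Q` IS `Q`» — verbatim the
  hypothesis `hM1` of ★-able `F0LD2ThetaRealisesOfMultiplicityOne.thetaLiftFromLineRealises_of_irreducible_of_multiplicityOne`.  Rank-generic `N`, any transport `ιA`.

References: [Liu2021] Y. Liu, Camb. J. Math. 9 (2021) = arXiv:2102.11518, App. B Cor. B.6 (1), (3) (arXiv p. 45).  [Wu2013] C. Wu, J. Number Theory 133 (2013), Thm. 5.1.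
[DeitmarEchterhoff2014] Cor. 6.1.9.  [Dixmier1977] §5.4.
-/

set_option autoImplicit false
-- the mandated namespace has the single-problem summit's repeated segment (`HodgeConjecture.HodgeConjecture`)
set_option linter.dupNamespace false

noncomputable section

open NumberField MeasureTheory IsDedekindDomain
open scoped Matrix ComplexOrder ENNReal InnerProductSpace
open Literature.NumberTheory.Automorphic Literature.NumberTheory.Automorphic.UnitaryGroup
open Literature.NumberTheory.Automorphic.UnitaryGroup.CotangentForms
open Literature.NumberTheory.Automorphic.IdeleClassGroup
open Literature.NumberTheory.Automorphic.Liu2021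
open Literature.NumberTheory.Automorphic.Liu2021.Def411WeilCarriers
open Literature.NumberTheory.Automorphic.Liu2021.Def411WeilCarriersDoubling
open Literature.NumberTheory.GelbartRogawski1991 Literature.NumberTheory.GelbartRogawski1991.UnitaryDualPair
open Literature.NumberTheory.Weil1964
open Literature.RepresentationTheory.Liu2021
open Literature.RepresentationTheory.CompactGroups
open Literature.RepresentationTheory.HeisenbergGroup

namespace Summit.HodgeConjecture.HodgeConjecture.Cruxes.HLiu418.F0LD2ThetaMultiplicityOneOfRealises

/-! ## §1 The isoclinic copy: realisation + irreducibility force multiplicity one -/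

section Hilbert

variable {G E : Type*} [Group G] [NormedAddCommGroup E] [InnerProductSpace ℂ E] [CompleteSpace E]
  {π : ContRepresentation ℂ G E}

/-- **Realisation ⟹ multiplicity one (isoclinic-copy argument).**  `π` any representation on a Hilbert space (unitarity is NOT needed for this direction);
`Q` an irreducible closed invariant subspace with carrier `closure (span S)`;
REALISATION PROPERTY: every irreducible closed invariant `W` whose orthogonal projection does not kill `S` lies inside `Q`.  Then every irreducible closed
invariant `W` unitarily equivalent to `Q` equals `Q`.  [cite: DeitmarEchterhoff2014, Cor. 6.1.9] [cite: Dixmier1977, §5.4] -/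
theorem eq_of_areUnitarilyEquivalent_of_realises {Q : ContRepresentation.ClosedSubrep π}
    (hQirr : Q.toContRep.IsTopIrreducible) {S : Set E}
    (hS : (Q.toSubmodule : Set E) = closure (Submodule.span ℂ S : Set E))
    (hReal : ∀ W : ContRepresentation.ClosedSubrep π, W.toContRep.IsTopIrreducible →
      (∃ v ∈ S, W.toSubmodule.starProjection v ≠ 0) → W ≤ Q)
    (W : ContRepresentation.ClosedSubrep π) (hW : W.toContRep.IsTopIrreducible)
    (he : ContRepresentation.AreUnitarilyEquivalent W.toContRep Q.toContRep) : W = Q := by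
  have hWnt : Nontrivial W.toSubmodule := ((ContRepresentation.isTopIrreducible_iff _).1 hW).1
  by_cases hex : ∃ v ∈ S, W.toSubmodule.starProjection v ≠ 0
  · -- `pr_W` sees a generator: `W ≤ Q`, and `Q` irreducible
    exact ContRepresentation.ClosedSubrep.eq_of_le_of_isTopIrreducible hQirr hWnt (hReal W hW hex)
  · -- `pr_W` kills `S`, hence its span and the closure of the span: `Q ⟂ W`
    exfalso
    push Not at hex
    have hSW : S ⊆ W.toSubmoduleᗮ := fun v hv =>
      (Submodule.starProjection_apply_eq_zero_iff _).1 (hex v hv)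
    have hQW : (Q.toSubmodule : Set E) ⊆ W.toSubmoduleᗮ := by
      rw [hS]
      exact closure_minimal (Submodule.span_le.2 hSW) (Submodule.isClosed_orthogonal _)
    have horth : ∀ q ∈ Q.toSubmodule, ∀ w ∈ W.toSubmodule, ⟪(q : E), w⟫_ℂ = 0 := fun q hq w hw =>
      inner_eq_zero_symm.1 ((Submodule.mem_orthogonal _ _).1 (hQW hq) w hw)
    -- the isometric intertwiner `f : Q → W`
    obtain ⟨e, heIso⟩ := he
    let f : Q.toContRep.Equiv W.toContRep := e.symm
    have hfnorm : ∀ q : Q.toSubmodule, ‖(f q : W.toSubmodule)‖ = ‖q‖ := by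
      intro q
      have h1 : ‖e (f q)‖ = ‖f q‖ := heIso.norm_map_of_map_zero (map_zero e) (f q)
      rw [← h1]
      exact congrArg _ (e.apply_symm_apply q)
    have hfeq : ∀ (g : G) (q : Q.toSubmodule), f (Q.toContRep g q) = W.toContRep g (f q) := by
      intro g q
      have h := congrArg (fun T : Q.toSubmodule →L[ℂ] W.toSubmodule => T q) (f.isIntertwining g)
      exact h
    -- the isoclinic embedding `U q = (√2)⁻¹ • (q + f q)`
    have hinner0 : ∀ q : Q.toSubmodule, ⟪(q : E), ((f q : W.toSubmodule) : E)⟫_ℂ = 0 := fun q =>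
      horth q q.2 _ (f q).2
    have hnormsum : ∀ q : Q.toSubmodule, ‖(q : E) + ((f q : W.toSubmodule) : E)‖ = Real.sqrt 2 * ‖q‖ := by
      intro q
      have h2 : ‖(q : E) + ((f q : W.toSubmodule) : E)‖ * ‖(q : E) + ((f q : W.toSubmodule) : E)‖ = 2 * (‖q‖ * ‖q‖) := by
        rw [norm_add_sq_eq_norm_sq_add_norm_sq_of_inner_eq_zero _ _ (hinner0 q), Submodule.norm_coe, Submodule.norm_coe, hfnorm q]
        ring
      rw [← Real.sqrt_mul_self (norm_nonneg ((q : E) + ((f q : W.toSubmodule) : E))), h2,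
        Real.sqrt_mul' _ (mul_self_nonneg _), Real.sqrt_mul_self (norm_nonneg _)]
    have hsqrt2 : (0 : ℝ) < Real.sqrt 2 := Real.sqrt_pos.2 (by norm_num)
    let U : Q.toSubmodule →ₗᵢ[ℂ] E :=
      { toLinearMap := (((Real.sqrt 2)⁻¹ : ℝ) : ℂ) •
            (Q.toSubmodule.subtype + W.toSubmodule.subtype ∘ₗ (f.toContinuousLinearEquiv.toLinearEquiv : Q.toSubmodule →ₗ[ℂ] W.toSubmodule))
        norm_map' := fun q => by
          change ‖(((Real.sqrt 2)⁻¹ : ℝ) : ℂ) • ((q : E) + ((f q : W.toSubmodule) : E))‖ = ‖q‖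
          rw [norm_smul, Complex.norm_real, Real.norm_eq_abs, abs_of_nonneg (inv_nonneg.2 hsqrt2.le), hnormsum q,
            ← mul_assoc, inv_mul_cancel₀ hsqrt2.ne', one_mul] }
    have hUapply : ∀ q : Q.toSubmodule, U q = (((Real.sqrt 2)⁻¹ : ℝ) : ℂ) • ((q : E) + ((f q : W.toSubmodule) : E)) := fun q => rfl
    have hU : ∀ (g : G) (q : Q.toSubmodule), U (Q.toContRep g q) = π g (U q) := by
      intro g q
      rw [hUapply, hUapply, map_smul, map_add, hfeq g q, ContRepresentation.ClosedSubrep.coe_toContRep_apply,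
        ContRepresentation.ClosedSubrep.coe_toContRep_apply]
    -- the isoclinic copy `R`, irreducible
    let R : ContRepresentation.ClosedSubrep π := ContRepresentation.ClosedSubrep.ofLinearIsometry U hU
    have hRirr : R.toContRep.IsTopIrreducible :=
      (ContRepresentation.isTopIrreducible_congr (ContRepresentation.ClosedSubrep.equivOfLinearIsometry U hU)).1 hQirr
    -- a non-zero generator `v ∈ S` (exists: `Q ≠ 0` is the closure of `span S`)
    have hQnt : Nontrivial Q.toSubmodule := ((ContRepresentation.isTopIrreducible_iff _).1 hQirr).1
    obtain ⟨v, hvS, hv0⟩ : ∃ v ∈ S, v ≠ 0 := by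
      by_contra hnone
      push Not at hnone
      have hspan : Submodule.span ℂ S = ⊥ := Submodule.span_eq_bot.2 hnone
      have hQbot : (Q.toSubmodule : Set E) = {0} := by
        rw [hS, hspan]
        simp
      obtain ⟨⟨x, hx⟩, ⟨y, hy⟩, hxy⟩ := hQnt
      apply hxy
      have hx0 : x = 0 := by simpa [hQbot] using (show x ∈ (Q.toSubmodule : Set E) from hx)
      have hy0 : y = 0 := by simpa [hQbot] using (show y ∈ (Q.toSubmodule : Set E) from hy)
      exact Subtype.ext (hx0.trans hy0.symm)
    have hvQ : v ∈ Q.toSubmodule := by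
      have : v ∈ (Q.toSubmodule : Set E) := by
        rw [hS]
        exact subset_closure (Submodule.subset_span hvS)
      exact this
    -- `pr_R v ≠ 0`: `⟪U v, v⟫ = (√2)⁻¹ ‖v‖² ≠ 0`
    have hRv : R.toSubmodule.starProjection v ≠ 0 := by
      intro h0
      have hvR : v ∈ R.toSubmoduleᗮ := (Submodule.starProjection_apply_eq_zero_iff _).1 h0
      have hUvR : U ⟨v, hvQ⟩ ∈ R.toSubmodule := ⟨⟨v, hvQ⟩, rfl⟩
      have hinner : ⟪U ⟨v, hvQ⟩, v⟫_ℂ = 0 := (Submodule.mem_orthogonal _ _).1 hvR _ hUvR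
      rw [hUapply, inner_smul_left, inner_add_left] at hinner
      have hfv : ⟪((f ⟨v, hvQ⟩ : W.toSubmodule) : E), v⟫_ℂ = 0 :=
        inner_eq_zero_symm.1 (hinner0 ⟨v, hvQ⟩)
      rw [hfv, add_zero, mul_eq_zero] at hinner
      rcases hinner with hc | hvv
      · exact (show (starRingEnd ℂ) ((((Real.sqrt 2)⁻¹ : ℝ) : ℂ)) ≠ 0 by
          rw [Complex.conj_ofReal]; exact_mod_cast inv_ne_zero hsqrt2.ne') hc
      · exact hv0 (inner_self_eq_zero.1 hvv)
    -- the realisation property puts `R` inside `Q`; then `f v ∈ Q ∩ W = 0`, so `v = 0`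
    have hRQ : R ≤ Q := hReal R hRirr ⟨v, hvS, hRv⟩
    have hUvQ : U ⟨v, hvQ⟩ ∈ Q.toSubmodule := hRQ (show U ⟨v, hvQ⟩ ∈ R from ⟨⟨v, hvQ⟩, rfl⟩)
    have hsumQ : (v : E) + ((f ⟨v, hvQ⟩ : W.toSubmodule) : E) ∈ Q.toSubmodule := by
      have hc : ((((Real.sqrt 2)⁻¹ : ℝ) : ℂ)) ≠ 0 := by
        exact_mod_cast inv_ne_zero hsqrt2.ne'
      rw [hUapply] at hUvQ
      exact (Submodule.smul_mem_iff _ hc).1 hUvQ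
    have hfvQ : ((f ⟨v, hvQ⟩ : W.toSubmodule) : E) ∈ Q.toSubmodule := by
      have h := Submodule.sub_mem _ hsumQ hvQ
      simpa using h
    have hfv0 : ((f ⟨v, hvQ⟩ : W.toSubmodule) : E) = 0 :=
      inner_self_eq_zero.1 (horth _ hfvQ _ (f ⟨v, hvQ⟩).2)
    apply hv0
    have hn : ‖(⟨v, hvQ⟩ : Q.toSubmodule)‖ = 0 := by
      rw [← hfnorm ⟨v, hvQ⟩, ← Submodule.norm_coe, hfv0, norm_zero]
    simpa [Submodule.norm_coe] using hn

end Hilbert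

/-! ## §2 The theta specialisation: (B6) ∧ (I′) ⟹ (M1θ) -/

section Theta

variable (L : Type) [Field L] [NumberField L] [IsCMField L] (N : ℕ) (H : Matrix (Fin N) (Fin N) L)
  {n' : ℕ} (e₁ : Fin N × Fin 1 ≃ Fin n') (dV : Fin N → L) (hdV : ∀ i, IsCMField.complexConj L (dV i) = dV i)
  (hdV0 : ∀ i, dV i ≠ 0)
  (ιA : (adelicGroupData (↥(maximalRealSubfield L)) L (IsCMField.complexConj L) N H).Adelic →* ↥(UnitaryGroup.adelic (↥(maximalRealSubfield L)) L (IsCMField.complexConj L) N (Matrix.diagonal dV)))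
  [CompactSpace (↥(UnitaryGroup.adelic (↥(maximalRealSubfield L)) L (IsCMField.complexConj L) N (Matrix.diagonal dV)) ⧸ (UnitaryGroup.toAdelic (↥(maximalRealSubfield L)) L (IsCMField.complexConj L) N (Matrix.diagonal dV)).range)]
  {μA : Measure (adelicGroupData (↥(maximalRealSubfield L)) L (IsCMField.complexConj L) N H).automorphicQuotient} [(adelicGroupData (↥(maximalRealSubfield L)) L (IsCMField.complexConj L) N H).IsAutomorphicMeasure μA]

/-- **(B6) ∧ (I′) ⟹ (M1θ)**: if the realisation row `ThetaLiftFromLineRealises` and the irreducibility row `ThetaLiftFromLineIrreducible` hold for the data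
`(L, N, H, e₁, dV, ιA, μA, μ, a, ξ)`, then the closed `(a, ξ)`-theta span has MULTIPLICITY ONE in `L²([U(H)], μA)`: every discrete automorphic `P` unitarily
equivalent to a closed invariant `Q` whose carrier is that span IS `Q` (for `Q = 0` vacuously: an irreducible `P` is not equivalent to `0`).  This is the
hypothesis `hM1` of `F0LD2ThetaRealisesOfMultiplicityOne.thetaLiftFromLineRealises_of_irreducible_of_multiplicityOne` verbatim, closing the equivalence
«(B6) ⟺ (M1θ) given (I′)».  [cite: Liu2021, App. B Cor. B.6 (1), (3) (p. 99)] [cite: Wu2013, Thm. 5.1] [cite: DeitmarEchterhoff2014, Cor. 6.1.9] -/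
theorem multiplicityOne_of_thetaLiftFromLineRealises
    (μ : Literature.NumberTheory.Automorphic.IdeleClassGroup L →ₜ* Circle) (hμ : IsConjugateSymplectic L μ) (a : (↥(maximalRealSubfield L))ˣ)
    (ξ : haveI := normal_range_toAdelic_JW L a
      PontryaginDual (↥(UnitaryGroup.adelic (↥(maximalRealSubfield L)) L (IsCMField.complexConj L) 1 (JW (↥(maximalRealSubfield L)) L a)) ⧸ (UnitaryGroup.toAdelic (↥(maximalRealSubfield L)) L (IsCMField.complexConj L) 1 (JW (↥(maximalRealSubfield L)) L a)).range))
    (hReal : ThetaLiftFromLineRealises L N H e₁ dV hdV hdV0 ιA μA μ hμ a ξ)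
    (hIrr : ThetaLiftFromLineIrreducible L N H e₁ dV hdV hdV0 ιA μA μ hμ a ξ) :
    letI : MeasurableSpace (↥(UnitaryGroup.adelic (↥(maximalRealSubfield L)) L (IsCMField.complexConj L) 1 (JW (↥(maximalRealSubfield L)) L a)) ⧸ (UnitaryGroup.toAdelic (↥(maximalRealSubfield L)) L (IsCMField.complexConj L) 1 (JW (↥(maximalRealSubfield L)) L a)).range) := borel _
    haveI := normal_range_toAdelic_JW L a
    ∀ (Q : ContRepresentation.ClosedSubrep ((adelicGroupData (↥(maximalRealSubfield L)) L (IsCMField.complexConj L) N H).rightRegular μA)),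
      (Q.toSubmodule : Set ((adelicGroupData (↥(maximalRealSubfield L)) L (IsCMField.complexConj L) N H).L2 μA)) = closure (Submodule.span ℂ
        {v : (adelicGroupData (↥(maximalRealSubfield L)) L (IsCMField.complexConj L) N H).L2 μA | ∃ (hρ : HasThetaMajorants fun
      (p : ↥(UnitaryGroup.adelic (↥(maximalRealSubfield L)) L (IsCMField.complexConj L) N (Matrix.diagonal dV)) × ↥(UnitaryGroup.adelic (↥(maximalRealSubfield L)) L (IsCMField.complexConj L) 1 (JW (↥(maximalRealSubfield L)) L a))) (Φ : piSchwartzBruhat (↥(maximalRealSubfield L)) (Fin n')) =>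
        pairRep (↥(maximalRealSubfield L)) L (IsCMField.complexConj L) N 1 e₁ (Matrix.diagonal dV) (JW (↥(maximalRealSubfield L)) L a)
          (chiSplittingLine L e₁ dV hdV hdV0 (toHeckeCharacter L μ) (isUnitary_toHeckeCharacter L μ)
            ((isOscillatorChar_toHeckeCharacter_iff μ).mpr hμ) (TW (↥(maximalRealSubfield L)) a)
            (isUnit_det_TW (↥(maximalRealSubfield L)) a) (JW (↥(maximalRealSubfield L)) L a) (JW_eq (↥(maximalRealSubfield L)) L a))
          p Φ)
        (μW : Measure (↥(UnitaryGroup.adelic (↥(maximalRealSubfield L)) L (IsCMField.complexConj L) 1 (JW (↥(maximalRealSubfield L)) L a)) ⧸ (UnitaryGroup.toAdelic (↥(maximalRealSubfield L)) L (IsCMField.complexConj L) 1 (JW (↥(maximalRealSubfield L)) L a)).range)) (_ : IsFiniteMeasure μW)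
        (_ : SMulInvariantMeasure ↥(UnitaryGroup.adelic (↥(maximalRealSubfield L)) L (IsCMField.complexConj L) 1 (JW (↥(maximalRealSubfield L)) L a)) (↥(UnitaryGroup.adelic (↥(maximalRealSubfield L)) L (IsCMField.complexConj L) 1 (JW (↥(maximalRealSubfield L)) L a)) ⧸ (UnitaryGroup.toAdelic (↥(maximalRealSubfield L)) L (IsCMField.complexConj L) 1 (JW (↥(maximalRealSubfield L)) L a)).range) μW)
        (Ψ : piSchwartzBruhat (↥(maximalRealSubfield L)) (Fin n'))
        (hθ : MemLp (toQuotFun (adelicGroupData (↥(maximalRealSubfield L)) L (IsCMField.complexConj L) N H) fun x =>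
          (lineThetaKernelDatum L N e₁ dV hdV hdV0 μ hμ a hρ).thetaLiftFun μW Ψ (charCM ξ) (ιA x)) 2 μA),
        v = MemLp.toLp _ hθ} : Set ((adelicGroupData (↥(maximalRealSubfield L)) L (IsCMField.complexConj L) N H).L2 μA)) →
      ∀ P : DiscreteAutomorphicRep (adelicGroupData (↥(maximalRealSubfield L)) L (IsCMField.complexConj L) N H) μA,
        ContRepresentation.AreUnitarilyEquivalent P.space.toContRep Q.toContRep → P.space = Q := by
  letI : MeasurableSpace (↥(UnitaryGroup.adelic (↥(maximalRealSubfield L)) L (IsCMField.complexConj L) 1 (JW (↥(maximalRealSubfield L)) L a)) ⧸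
      (UnitaryGroup.toAdelic (↥(maximalRealSubfield L)) L (IsCMField.complexConj L) 1 (JW (↥(maximalRealSubfield L)) L a)).range) := borel _
  haveI := normal_range_toAdelic_JW L a
  intro Q hQcar P he
  rcases hIrr Q hQcar with hbot | hQirr
  · -- `Q = 0`: an irreducible `P` cannot be equivalent to it
    exfalso
    obtain ⟨e, -⟩ := he
    have hQirr' : Q.toContRep.IsTopIrreducible := (ContRepresentation.isTopIrreducible_congr e).1 P.irreducible
    have hnt : Nontrivial Q.toSubmodule := ((ContRepresentation.isTopIrreducible_iff _).1 hQirr').1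
    rw [hbot] at hnt
    exact not_nontrivial (⊥ : Submodule ℂ ((adelicGroupData (↥(maximalRealSubfield L)) L (IsCMField.complexConj L) N H).L2 μA)) hnt
  · refine eq_of_areUnitarilyEquivalent_of_realises hQirr hQcar ?_ P.space P.irreducible he
    -- the realisation property for irreducible closed invariant `W` = (B6) for the discrete automorphic representation `⟨W, hW⟩`
    rintro W hW ⟨v, ⟨hρ, μW, hfinW, hinvW, Ψ, hθ, rfl⟩, hne⟩
    have hsub := hReal ⟨W, hW⟩ ⟨hρ, μW, hfinW, hinvW, Ψ, hθ, hne⟩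
    intro w hw
    have hw' : w ∈ (Q.toSubmodule : Set ((adelicGroupData (↥(maximalRealSubfield L)) L (IsCMField.complexConj L) N H).L2 μA)) := by
      rw [hQcar]
      exact hsub hw
    exact hw'

end Theta

end Summit.HodgeConjecture.HodgeConjecture.Cruxes.HLiu418.F0LD2ThetaMultiplicityOneOfRealises

end
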